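import Mathlib
import Summits.KontsevichZagierPeriods.KontsevichZagierPeriods.Theorems.HyperbolicBlochZagierDilogarithmConjectureStubExplainedToKZ
import Summits.KontsevichZagierPeriods.KontsevichZagierPeriods.Theorems.HyperbolicBlochZagierDilogarithmConjectureStubHeptagonalMembership
import Summits.KontsevichZagierPeriods.KontsevichZagierPeriods.Theorems.HyperbolicBlochZagierDilogarithmConjectureStubHeptagonalDehnZero
import HarnessLib

/-!
# `ZagierDilogarithmConjecture` (stmt-KontsevichZagierPeriods-10550) — line `kummer-clausen-linearisation`
# (reshape c3, "certificate slice"): the heptagonal KZ relation, UNCONDITIONALLY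

**An unconditional instance of Kontsevich–Zagier's Conjecture 1 (kernel form) over a field with three complex places.**
For the standard KZ representations `ρ z = [T(z), t⁻³]` of the ideal hyperbolic tetrahedra, the formal combination
`7[ρ ζ₇] + 7[ρ ζ₇²] − 7[ρ ζ₇³] − 8[ρ ((1+√−7)/2)] − 4[ρ ((−1+√−7)/4)]` is a KZ relation — i.e. the numerical identity of
periods `7 vol T(ζ₇) + 7 vol T(ζ₇²) − 7 vol T(ζ₇³) = 8 vol T((1+√−7)/2) + 4 vol T((−1+√−7)/4)` (`= 10.6669791…`, a
`ζ_{ℚ(√−7)}(2)` relation of Zagier–Humbert type) is a consequence of the Kontsevich–Zagier rules. This is what the route's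
deciding theorem `closes` consumes from `hZ` (TetraSector's conclusion), here with NO appeal to Zagier's conjecture, Borel's
theorem or numerics: `stub_heptagonalMembership` (the formal five-term certificate, c3) composed with `stub_explainedToKZ`
(the five-term transfer `FiveTermTransfer_of`, c3 wave 1). Sorry-free; axioms ⊆ {propext, Classical.choice, Quot.sound}.
-/

noncomputable section

open scoped BigOperators ComplexConjugate
open Literature.NumberTheory.Transcendental

namespace Summit.KontsevichZagierPeriods.HyperbolicBloch.ZagierDilogarithmCertificate

/-- **The heptagonal KZ relation (unconditional).** For the standard tetrahedral representations `ρ`,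
`7[ρ ζ₇] + 7[ρ ζ₇²] − 7[ρ ζ₇³] − 8[ρ ((1+√−7)/2)] − 4[ρ ((−1+√−7)/4)] ∈ KZ.relations`.
[cite: Neumann1998, §2.1 end (pp. 393–394): Zagier's conjecture] -/
theorem heptagonalKZ :
    ∀ (T : ℂ → Set (Fin 3 → ℝ)), (∀ z, T z = {p | 0 < p 1 ∧ z.re * p 1 < z.im * p 0 ∧
      z.im * (p 0 - 1) < (z.re - 1) * p 1 ∧ 0 < p 2 ∧
      0 < z.im * (p 0 ^ 2 + p 1 ^ 2 + p 2 ^ 2 - p 0) + (z.re - Complex.normSq z) * p 1}) →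
    ∀ (ρ : ℂ → KZ.IntegralRep 3), (∀ z, IsAlgebraic ℚ z → 0 < z.im →
      (ρ z).domain = T z ∧ Set.EqOn (ρ z).integrand (fun p => 1 / p 2 ^ 3) (T z)) →
      ((7 : ℤ) • KZ.of (ρ (Complex.exp (2 * Real.pi * Complex.I / 7))) +
        (7 : ℤ) • KZ.of (ρ (Complex.exp (2 * Real.pi * Complex.I / 7) ^ 2)) -
        (7 : ℤ) • KZ.of (ρ (Complex.exp (2 * Real.pi * Complex.I / 7) ^ 3)) -
        (8 : ℤ) • KZ.of (ρ ((1 + (Real.sqrt 7 : ℂ) * Complex.I) / 2)) -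
        (4 : ℤ) • KZ.of (ρ ((-1 + (Real.sqrt 7 : ℂ) * Complex.I) / 4))) ∈ KZ.relations := by
  intro T hT ρ hρ
  set ζ : ℂ := Complex.exp (2 * Real.pi * Complex.I / 7) with hζdef
  set x : ℂ := (1 + (Real.sqrt 7 : ℂ) * Complex.I) / 2 with hxdef
  set y : ℂ := (-1 + (Real.sqrt 7 : ℂ) * Complex.I) / 4 with hydef
  have him : ∀ i : Fin 5, 0 < ((![ζ, ζ ^ 2, ζ ^ 3, x, y] : Fin 5 → ℂ) i).im :=
    Summit.KontsevichZagierPeriods.HyperbolicBloch.ZagierDilogarithmGaloisDescent.hept_im_pos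
  have hmem := stub_heptagonalMembership
  have e : (∑ i : Fin 5, (![7, 7, -7, -8, -4] : Fin 5 → ℤ) i •
      FreeAbelianGroup.of ((![ζ, ζ ^ 2, ζ ^ 3, x, y] : Fin 5 → ℂ) i)) =
      (7 : ℤ) • FreeAbelianGroup.of ζ + (7 : ℤ) • FreeAbelianGroup.of (ζ ^ 2) -
        (7 : ℤ) • FreeAbelianGroup.of (ζ ^ 3) - (8 : ℤ) • FreeAbelianGroup.of x -
        (4 : ℤ) • FreeAbelianGroup.of y := by
    simp only [Fin.sum_univ_five, Matrix.cons_val_zero, Matrix.cons_val_one, Matrix.head_cons,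
      Matrix.cons_val_two, Matrix.tail_cons, Matrix.cons_val_three, Matrix.cons_val_four, neg_smul]
    abel
  have key := stub_explainedToKZ T hT ρ hρ 5 (![ζ, ζ ^ 2, ζ ^ 3, x, y]) (![7, 7, -7, -8, -4]) him
    (by rw [e]; exact hmem)
  have e' : (∑ i : Fin 5, (![7, 7, -7, -8, -4] : Fin 5 → ℤ) i •
      KZ.of (ρ ((![ζ, ζ ^ 2, ζ ^ 3, x, y] : Fin 5 → ℂ) i))) =
      (7 : ℤ) • KZ.of (ρ ζ) + (7 : ℤ) • KZ.of (ρ (ζ ^ 2)) - (7 : ℤ) • KZ.of (ρ (ζ ^ 3)) -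
        (8 : ℤ) • KZ.of (ρ x) - (4 : ℤ) • KZ.of (ρ y) := by
    simp only [Fin.sum_univ_five, Matrix.cons_val_zero, Matrix.cons_val_one, Matrix.head_cons,
      Matrix.cons_val_two, Matrix.tail_cons, Matrix.cons_val_three, Matrix.cons_val_four, neg_smul]
    abel
  rw [e'] at key
  exact key

end Summit.KontsevichZagierPeriods.HyperbolicBloch.ZagierDilogarithmCertificate

end
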